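import Summits.QuantumFields.YangMills.Theorems.ColdStartUniversalityColdStartSolutionsExistTangentBounds
import Summits.QuantumFields.YangMills.Theorems.ColdStartUniversalityColdStartSolutionsExistTangentPath
import Summits.QuantumFields.YangMills.Theorems.ColdStartUniversalityColdStartSolutionsExistTangentLevel
import HarnessLib

/-!
# Route `ColdStartUniversality`, support item S (stmt-QuantumFields-24811), line `piwiener`:
# stub B1 — assembly at a fixed dyadic level

Helper file (lead `ym-line-csu-p1`) for stub B1 `stub_tangentSumSq` (scaffold
`Cruxes/ColdStartSolutionsExist/Lines/piwiener_B1_scaffold.lean`).  For the tangent system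
`Y_k = y_k + ∫ b_k ds + Σ_{n'} J'_{k n'}`, `J'_{k n'} = ∫ σ_{k n'} dW^{c n'}` (martingale versions) with
`T2 : Σ_k Y_k σ_{k n'} ≡ 0`, at dyadic level `n` with `N ≤ n 2ⁿ` cells inside `[0, t]` and truncation
levels `C ≤ n` (for `Y`) and `n` (for `σ`):

* `level_pointwise` — a.s. on the event `{|Y| ≤ C, |σ| ≤ n at the dyadic points of [0, t]}`,
  `min 1 |Σ_k Y_k(N/2ⁿ)² − Σ_k Y_k(0)²|` is bounded by the sum of the PATH, II, GAUSS, drift/sampling-error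
  and `θ`-weighted `m²` terms of `levelIdentity` / `min_one_abs_level_le` (all clamps inactive there);
* `level_integral` — integrating: `E[min 1 |…| ; event] ≤ E min 1 |PATH| + Σ 2√(C² 4ε) + (Gauss rates)
  + (1 + 1/θ)(E min 1 (2ΣΔA²) + 2|κ| Σ 4ε) + θ |κ| (N/2ⁿ) Σ E[sup σ²]`.

No definition, no sorry.  RECORD-rung plumbing; nothing here bears on the Yang–Mills mass gap. -/

set_option autoImplicit false

noncomputable section

namespace Summit.QuantumFields.YangMills.Theorems.ColdStartUniversality

open MeasureTheory ProbabilityTheory Filter Topology Finset Literature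
open scoped NNReal ENNReal BigOperators
open Literature.Probability.Process

variable {Ω : Type} {mΩ : MeasurableSpace Ω} {P : Measure Ω} {d : ℕ} {W : ℝ≥0 → Ω → (Fin d → ℝ)}

/-- Grid points `j/2ⁿ`, `j ≤ N`, lie in `[0, t]` when `N/2ⁿ ≤ t`. [folklore] -/
theorem dyadicGrid_le {t : ℝ≥0} {n N j : ℕ} (hNt : ((N : ℝ≥0) / 2 ^ n) ≤ t) (hj : j ≤ N) :
    ((j : ℝ≥0) / 2 ^ n) ≤ t :=
  (div_le_div_of_nonneg_right (by exact_mod_cast hj) (pow_pos two_pos n).le).trans hNt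

/-- **The level-`n` bound, pointwise on the good event** (see the file header). [folklore] -/
theorem level_pointwise [IsProbabilityMeasure P] (hW : IsBrownianVec W P) {ι κ : Type} [Fintype ι]
    [Fintype κ] [DecidableEq κ] (c : κ → Fin d) (Y b : ι → ℝ≥0 → Ω → ℝ) (σ J' : ι → κ → ℝ≥0 → Ω → ℝ)
    (y₀ : ι → ℝ) (hσa : ∀ k n', Adapted hW.natFiltration (σ k n'))
    (hbc : ∀ᵐ ω ∂P, ∀ k, Continuous fun t => b k t ω)
    (hXeq : ∀ᵐ ω ∂P, ∀ (t : ℝ≥0) (k : ι),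
      Y k t ω = y₀ k + (∫ s in (0 : ℝ)..t, b k s.toNNReal ω) + ∑ n', J' k n' t ω)
    (hT2 : ∀ (t : ℝ≥0) (ω : Ω) (n' : κ), ∑ k, Y k t ω * σ k n' t ω = 0)
    {t : ℝ≥0} {n N C : ℕ} (hN : N ≤ n * 2 ^ n) (hNt : ((N : ℝ≥0) / 2 ^ n) ≤ t) (hCn : C ≤ n)
    {θ : ℝ} (hθ : 0 < θ) :
    ∀ᵐ ω ∂P, (∀ k (m j : ℕ), ((j : ℝ≥0) / 2 ^ m) ≤ t → |Y k ((j : ℝ≥0) / 2 ^ m) ω| ≤ C) →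
      (∀ k n' (m j : ℕ), ((j : ℝ≥0) / 2 ^ m) ≤ t → |σ k n' ((j : ℝ≥0) / 2 ^ m) ω| ≤ n) →
      min 1 |(∑ k, Y k ((N : ℝ≥0) / 2 ^ n) ω ^ 2 - ∑ k, Y k 0 ω ^ 2)| ≤
        min 1 |(∑ j ∈ range N, ∑ k, 2 * Y k ((j : ℝ≥0) / 2 ^ n) ω * (∫ s in ((((j : ℝ≥0) / 2 ^ n : ℝ≥0)) : ℝ)..((((j + 1 : ℕ) : ℝ≥0) / 2 ^ n : ℝ≥0) : ℝ), b k s.toNNReal ω) + ∑ j ∈ range N, ∑ k, ∑ n', clamp n (σ k n' ((j : ℝ≥0) / 2 ^ n) ω) ^ 2 * (1 / 2 ^ n))| + ∑ k, ∑ n', 2 * |(∑ j ∈ range N, clamp n (clamp C (Y k ((j : ℝ≥0) / 2 ^ n) ω)) * ((J' k n' (((j + 1 : ℕ) : ℝ≥0) / 2 ^ n) ω - (SimpleProcess.sample (σ k n') (hσa k n') n).integral (fun t ω => W t ω (c n')) (((j + 1 : ℕ) : ℝ≥0) / 2 ^ n) ω) - (J' k n' ((j : ℝ≥0) / 2 ^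 n) ω - (SimpleProcess.sample (σ k n') (hσa k n') n).integral (fun t ω => W t ω (c n')) ((j : ℝ≥0) / 2 ^ n) ω)))| + (∑ k, ∑ n', |(∑ j ∈ range N, clamp n (σ k n' ((j : ℝ≥0) / 2 ^ n) ω) ^ 2 * ((W (((j + 1 : ℕ) : ℝ≥0) / 2 ^ n) ω (c n') - W ((j : ℝ≥0) / 2 ^ n) ω (c n')) ^ 2 - 1 / 2 ^ n))| + ∑ k, ∑ n', ∑ n'' ∈ univ.erase n', |(∑ j ∈ range N, (clamp n (σ k n' ((j : ℝ≥0) / 2 ^ n) ω) * clamp n (σ k n'' ((j : ℝ≥0) / 2 ^ n) ω)) * ((W (((j + 1 : ℕ) : ℝ≥0) / 2 ^ n) ω (c n') - W ((j : ℝ≥0) / 2 ^ n) ω (c n')) * (W (((j + 1 : ℕ) : ℝ≥0) / 2 ^ n) ω (c n'') - W ((j : ℝ≥0) / 2 ^ n) ω (c n''))))|) + (1 + 1 / θ) * (min 1 (2 * ∑ j ∈ range N, ∑ k, (∫ s in ((((j : ℝ≥0) / 2 ^ n : ℝ≥0)) : ℝ)..((((j + 1 : ℕ) : ℝ≥0)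 / 2 ^ n : ℝ≥0) : ℝ), b k s.toNNReal ω) ^ 2) + (2 * Fintype.card κ * ∑ k, ∑ n', ∑ j ∈ range N, ((J' k n' (((j + 1 : ℕ) : ℝ≥0) / 2 ^ n) ω - (SimpleProcess.sample (σ k n') (hσa k n') n).integral (fun t ω => W t ω (c n')) (((j + 1 : ℕ) : ℝ≥0) / 2 ^ n) ω) - (J' k n' ((j : ℝ≥0) / 2 ^ n) ω - (SimpleProcess.sample (σ k n') (hσa k n') n).integral (fun t ω => W t ω (c n')) ((j : ℝ≥0) / 2 ^ n) ω)) ^ 2)) + θ * (Fintype.card κ * ∑ k, ∑ n', ∑ j ∈ range N, clamp n (σ k n' ((j : ℝ≥0) / 2 ^ n) ω) ^ 2 * (W (((j + 1 : ℕ) : ℝ≥0) / 2 ^ n) ω (c n') - W ((j : ℝ≥0) / 2 ^ n) ω (c n')) ^ 2) := by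
  filter_upwards [hbc, hXeq] with ω hbω hXω hEC hES
  have hjN : ∀ j, j < N → j + 1 ≤ n * 2 ^ n := fun j hj => by omega
  -- (1) the increment equation on the grid
  have hstep : ∀ j < N, ∀ k, Y k (((j + 1 : ℕ) : ℝ≥0) / 2 ^ n) ω - Y k ((j : ℝ≥0) / 2 ^ n) ω =
      (∫ s in ((((j : ℝ≥0) / 2 ^ n : ℝ≥0)) : ℝ)..((((j + 1 : ℕ) : ℝ≥0) / 2 ^ n : ℝ≥0) : ℝ), b k s.toNNReal ω) + ∑ n', ((J' k n' (((j + 1 : ℕ) : ℝ≥0) / 2 ^ n) ω - (SimpleProcess.sample (σ k n') (hσa k n') n).integral (fun t ω => W t ω (c n')) (((j + 1 : ℕ) : ℝ≥0) / 2 ^ n) ω) - (J' k n' ((j : ℝ≥0) / 2 ^ n) ω - (SimpleProcess.sample (σ k n') (hσa k n') n).integral (fun t ω => W t ω (c n')) ((j : ℝ≥0) / 2 ^ n) ω)) + ∑ n', clamp n (σ k n' ((j : ℝ≥0) / 2 ^ n) ω) * (W (((j + 1 : ℕ) : ℝ≥0) / 2 ^ n) ω (c n') - W ((j : ℝ≥0)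 / 2 ^ n) ω (c n')) := by
    intro j hj k
    have hbi : ∀ a a' : ℝ, IntervalIntegrable (fun s : ℝ => b k s.toNNReal ω) volume a a' := fun a a' =>
      ((hbω k).comp continuous_real_toNNReal).intervalIntegrable _ _
    have hA : (∫ s in (0 : ℝ)..((((j + 1 : ℕ) : ℝ≥0) / 2 ^ n : ℝ≥0) : ℝ), b k s.toNNReal ω) - (∫ s in (0 : ℝ)..((((j : ℝ≥0) / 2 ^ n : ℝ≥0)) : ℝ), b k s.toNNReal ω) =
        (∫ s in ((((j : ℝ≥0) / 2 ^ n : ℝ≥0)) : ℝ)..((((j + 1 : ℕ) : ℝ≥0) / 2 ^ n : ℝ≥0) : ℝ), b k s.toNNReal ω) := intervalIntegral.integral_interval_sub_left (hbi _ _) (hbi _ _)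
    have hJ : ∀ n', J' k n' (((j + 1 : ℕ) : ℝ≥0) / 2 ^ n) ω - J' k n' ((j : ℝ≥0) / 2 ^ n) ω = ((J' k n' (((j + 1 : ℕ) : ℝ≥0) / 2 ^ n) ω - (SimpleProcess.sample (σ k n') (hσa k n') n).integral (fun t ω => W t ω (c n')) (((j + 1 : ℕ) : ℝ≥0) / 2 ^ n) ω) - (J' k n' ((j : ℝ≥0) / 2 ^ n) ω - (SimpleProcess.sample (σ k n') (hσa k n') n).integral (fun t ω => W t ω (c n')) ((j : ℝ≥0) / 2 ^ n) ω)) + clamp n (σ k n' ((j : ℝ≥0) / 2 ^ n) ω) * (W (((j + 1 : ℕ) : ℝ≥0) / 2 ^ n) ω (c n') - W ((j : ℝ≥0) / 2 ^ n) ω (c n')) := by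
      intro n'
      have h := sample_integral_dyadic_succ_sub (hσa k n') n (fun t ω => W t ω (c n')) (hjN j hj) ω
      linear_combination h
    rw [hXω (((j + 1 : ℕ) : ℝ≥0) / 2 ^ n) k, hXω ((j : ℝ≥0) / 2 ^ n) k]
    calc y₀ k + (∫ s in (0 : ℝ)..((((j + 1 : ℕ) : ℝ≥0) / 2 ^ n : ℝ≥0) : ℝ), b k s.toNNReal ω) + ∑ n', J' k n' (((j + 1 : ℕ) : ℝ≥0) / 2 ^ n) ω -
          (y₀ k + (∫ s in (0 : ℝ)..((((j : ℝ≥0) / 2 ^ n : ℝ≥0)) : ℝ), b k s.toNNReal ω) + ∑ n', J' k n' ((j : ℝ≥0) / 2 ^ n) ω)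
        = ((∫ s in (0 : ℝ)..((((j + 1 : ℕ) : ℝ≥0) / 2 ^ n : ℝ≥0) : ℝ), b k s.toNNReal ω) - (∫ s in (0 : ℝ)..((((j : ℝ≥0) / 2 ^ n : ℝ≥0)) : ℝ), b k s.toNNReal ω)) +
          ∑ n', (J' k n' (((j + 1 : ℕ) : ℝ≥0) / 2 ^ n) ω - J' k n' ((j : ℝ≥0) / 2 ^ n) ω) := by rw [Finset.sum_sub_distrib]; ring
      _ = (∫ s in ((((j : ℝ≥0) / 2 ^ n : ℝ≥0)) : ℝ)..((((j + 1 : ℕ) : ℝ≥0) / 2 ^ n : ℝ≥0) : ℝ), b k s.toNNReal ω) + ∑ n', (((J' k n' (((j + 1 : ℕ) : ℝ≥0) / 2 ^ n) ω - (SimpleProcess.sample (σ k n') (hσa k n') n).integral (fun t ω => W t ω (c n')) (((j + 1 : ℕ) : ℝ≥0) / 2 ^ n) ω) - (J' k n' ((j : ℝ≥0) / 2 ^ n) ω - (SimpleProcess.sample (σ k n') (hσa k n') n).integral (fun t ω => W t ω (c n')) ((j : ℝ≥0) / 2 ^ n) ω)) + clamp n (σ k n' ((j : ℝ≥0) / 2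 ^ n) ω) * (W (((j + 1 : ℕ) : ℝ≥0) / 2 ^ n) ω (c n') - W ((j : ℝ≥0) / 2 ^ n) ω (c n'))) := by
          rw [hA]; exact congrArg _ (Finset.sum_congr rfl fun n' _ => hJ n')
      _ = _ := by rw [Finset.sum_add_distrib, add_assoc]
  -- (2) tangency `T2` at the grid points (clamp on `σ` inactive there)
  have hT2' : ∀ j < N, ∀ n', ∑ k, Y k ((j : ℝ≥0) / 2 ^ n) ω * clamp n (σ k n' ((j : ℝ≥0) / 2 ^ n) ω) = 0 := by
    intro j hj n'
    rw [← hT2 ((j : ℝ≥0) / 2 ^ n) ω n']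
    exact Finset.sum_congr rfl fun k _ => by rw [clamp_eq_self (hES k n' n j (dyadicGrid_le hNt hj.le))]
  -- (3) the exact decomposition
  have hid := levelIdentity N (1 / 2 ^ n) (fun k j => Y k ((j : ℝ≥0) / 2 ^ n) ω) (fun k j => (∫ s in ((((j : ℝ≥0) / 2 ^ n : ℝ≥0)) : ℝ)..((((j + 1 : ℕ) : ℝ≥0) / 2 ^ n : ℝ≥0) : ℝ), b k s.toNNReal ω))
    (fun k n' j => ((J' k n' (((j + 1 : ℕ) : ℝ≥0) / 2 ^ n) ω - (SimpleProcess.sample (σ k n') (hσa k n') n).integral (fun t ω => W t ω (c n')) (((j + 1 : ℕ) : ℝ≥0) / 2 ^ n) ω) - (J' k n' ((j : ℝ≥0) / 2 ^ n) ω - (SimpleProcess.sample (σ k n') (hσa k n') n).integral (fun t ω => W t ω (c n')) ((j : ℝ≥0) / 2 ^ n) ω))) (fun k n' j => clamp n (σ k n' ((j : ℝ≥0) / 2 ^ n) ω)) (fun n' j => (W (((j + 1 : ℕ) : ℝ≥0) / 2 ^ n) ω (c n') - W ((j : ℝ≥0) / 2 ^ n) ω (c n'))) hstep hT2'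
  beta_reduce at hid
  simp only [Nat.cast_zero, zero_div] at hid
  have hmin := min_one_abs_level_le N hθ (fun k j => (∫ s in ((((j : ℝ≥0) / 2 ^ n : ℝ≥0)) : ℝ)..((((j + 1 : ℕ) : ℝ≥0) / 2 ^ n : ℝ≥0) : ℝ), b k s.toNNReal ω)) (fun k n' j => ((J' k n' (((j + 1 : ℕ) : ℝ≥0) / 2 ^ n) ω - (SimpleProcess.sample (σ k n') (hσa k n') n).integral (fun t ω => W t ω (c n')) (((j + 1 : ℕ) : ℝ≥0) / 2 ^ n) ω) - (J' k n' ((j : ℝ≥0) / 2 ^ n) ω - (SimpleProcess.sample (σ k n') (hσa k n') n).integral (fun t ω => W t ω (c n')) ((j : ℝ≥0) / 2 ^ n) ω)))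
    (fun k n' j => clamp n (σ k n' ((j : ℝ≥0) / 2 ^ n) ω)) (fun n' j => (W (((j + 1 : ℕ) : ℝ≥0) / 2 ^ n) ω (c n') - W ((j : ℝ≥0) / 2 ^ n) ω (c n'))) hid
  beta_reduce at hmin
  refine hmin.trans ?_
  -- (4) the II term: on the event the clamps on `Y` are inactive
  have hYcl : ∀ j < N, ∀ k, clamp n (clamp C (Y k ((j : ℝ≥0) / 2 ^ n) ω)) = Y k ((j : ℝ≥0) / 2 ^ n) ω := by
    intro j hj k
    have h1 : |Y k ((j : ℝ≥0) / 2 ^ n) ω| ≤ C := hEC k n j (dyadicGrid_le hNt hj.le)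
    rw [clamp_eq_self h1, clamp_eq_self (h1.trans (by exact_mod_cast hCn))]
  have hTI : |∑ k, ∑ n', 2 * ∑ j ∈ range N, Y k ((j : ℝ≥0) / 2 ^ n) ω * ((J' k n' (((j + 1 : ℕ) : ℝ≥0) / 2 ^ n) ω - (SimpleProcess.sample (σ k n') (hσa k n') n).integral (fun t ω => W t ω (c n')) (((j + 1 : ℕ) : ℝ≥0) / 2 ^ n) ω) - (J' k n' ((j : ℝ≥0) / 2 ^ n) ω - (SimpleProcess.sample (σ k n') (hσa k n') n).integral (fun t ω => W t ω (c n')) ((j : ℝ≥0) / 2 ^ n) ω))| ≤ ∑ k, ∑ n', 2 * |(∑ j ∈ range N, clamp n (clamp C (Y k ((j : ℝ≥0) / 2 ^ n) ω)) * ((J' k n' (((j + 1 : ℕ) : ℝ≥0) / 2 ^ n) ω - (SimpleProcess.sample (σ k n') (hσa k n') n).integral (fun t ω => W t ω (c n')) (((j + 1 : ℕ) : ℝ≥0) / 2 ^ n) ω) - (J' k n' ((j : ℝ≥0) / 2 ^ n) ω - (SimpleProcess.sample (σ k n') (hσa k n') n).integral (fun t ω => W t ω (c n')) ((j : ℝ≥0)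 / 2 ^ n) ω)))| := by
    refine (Finset.abs_sum_le_sum_abs _ _).trans (Finset.sum_le_sum fun k _ =>
      (Finset.abs_sum_le_sum_abs _ _).trans (Finset.sum_le_sum fun n' _ => ?_))
    rw [abs_mul, abs_two]
    refine le_of_eq (congrArg (fun x => 2 * |x|) (Finset.sum_congr rfl fun j hj => ?_))
    rw [hYcl j (mem_range.1 hj) k]
  -- (5) the Gauss term
  have hG : |∑ k, ∑ n', (∑ j ∈ range N, clamp n (σ k n' ((j : ℝ≥0) / 2 ^ n) ω) ^ 2 * ((W (((j + 1 : ℕ) : ℝ≥0) / 2 ^ n) ω (c n') - W ((j : ℝ≥0) / 2 ^ n) ω (c n')) ^ 2 - 1 / 2 ^ n)) + ∑ k, ∑ n', ∑ n'' ∈ univ.erase n', (∑ j ∈ range N, (clamp n (σ k n' ((j : ℝ≥0) / 2 ^ n) ω) * clamp n (σ k n'' ((j : ℝ≥0) / 2 ^ n) ω)) * ((W (((j + 1 : ℕ) : ℝ≥0) / 2 ^ n) ω (c n') - W ((j : ℝ≥0) / 2 ^ n) ω (c n')) * (W (((j + 1 : ℕ) : ℝ≥0) / 2 ^ n) ω (c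 n'') - W ((j : ℝ≥0) / 2 ^ n) ω (c n''))))| ≤
      ∑ k, ∑ n', |(∑ j ∈ range N, clamp n (σ k n' ((j : ℝ≥0) / 2 ^ n) ω) ^ 2 * ((W (((j + 1 : ℕ) : ℝ≥0) / 2 ^ n) ω (c n') - W ((j : ℝ≥0) / 2 ^ n) ω (c n')) ^ 2 - 1 / 2 ^ n))| + ∑ k, ∑ n', ∑ n'' ∈ univ.erase n', |(∑ j ∈ range N, (clamp n (σ k n' ((j : ℝ≥0) / 2 ^ n) ω) * clamp n (σ k n'' ((j : ℝ≥0) / 2 ^ n) ω)) * ((W (((j + 1 : ℕ) : ℝ≥0) / 2 ^ n) ω (c n') - W ((j : ℝ≥0) / 2 ^ n) ω (c n')) * (W (((j + 1 : ℕ) : ℝ≥0) / 2 ^ n) ω (c n'') - W ((j : ℝ≥0) / 2 ^ n) ω (c n''))))| := by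
    refine (abs_add_le _ _).trans (add_le_add ?_ ?_)
    · exact (Finset.abs_sum_le_sum_abs _ _).trans (Finset.sum_le_sum fun k _ => Finset.abs_sum_le_sum_abs _ _)
    · exact (Finset.abs_sum_le_sum_abs _ _).trans (Finset.sum_le_sum fun k _ =>
        (Finset.abs_sum_le_sum_abs _ _).trans (Finset.sum_le_sum fun n' _ => Finset.abs_sum_le_sum_abs _ _))
  -- (6) the `m²` term: Cauchy–Schwarz over `n'`
  have hM : ∑ j ∈ range N, ∑ k, (∑ n', clamp n (σ k n' ((j : ℝ≥0) / 2 ^ n) ω) * (W (((j + 1 : ℕ) : ℝ≥0) / 2 ^ n) ω (c n') - W ((j : ℝ≥0) / 2 ^ n) ω (c n'))) ^ 2 ≤ (Fintype.card κ * ∑ j ∈ range N, ∑ k, ∑ n', clamp n (σ k n' ((j : ℝ≥0) / 2 ^ n) ω) ^ 2 * (W (((j + 1 : ℕ) : ℝ≥0) / 2 ^ n) ω (c n') - W ((j : ℝ≥0) / 2 ^ n) ω (c n')) ^ 2) := by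
    rw [Finset.mul_sum]
    refine Finset.sum_le_sum fun j _ => ?_
    rw [Finset.mul_sum]
    refine Finset.sum_le_sum fun k _ => ?_
    have h := sq_sum_le_card_mul_sum_sq (s := (univ : Finset κ)) (f := fun n' => clamp n (σ k n' ((j : ℝ≥0) / 2 ^ n) ω) * (W (((j + 1 : ℕ) : ℝ≥0) / 2 ^ n) ω (c n') - W ((j : ℝ≥0) / 2 ^ n) ω (c n')))
    simp only [Finset.card_univ, mul_pow] at h
    exact h
  have hθM := mul_le_mul_of_nonneg_left hM hθ.le
  have hsw1 : ∑ j ∈ range N, ∑ k, ∑ n', ((J' k n' (((j + 1 : ℕ) : ℝ≥0) / 2 ^ n) ω - (SimpleProcess.sample (σ k n') (hσa k n') n).integral (fun t ω => W t ω (c n')) (((j + 1 : ℕ) : ℝ≥0) / 2 ^ n) ω) - (J' k n' ((j : ℝ≥0) / 2 ^ n) ω - (SimpleProcess.sample (σ k n') (hσa k n') n).integral (fun t ω => W t ω (c n')) ((j : ℝ≥0) / 2 ^ n) ω)) ^ 2 = ∑ k, ∑ n', ∑ j ∈ range N, ((J' k n' (((j + 1 : ℕ) : ℝ≥0) / 2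 ^ n) ω - (SimpleProcess.sample (σ k n') (hσa k n') n).integral (fun t ω => W t ω (c n')) (((j + 1 : ℕ) : ℝ≥0) / 2 ^ n) ω) - (J' k n' ((j : ℝ≥0) / 2 ^ n) ω - (SimpleProcess.sample (σ k n') (hσa k n') n).integral (fun t ω => W t ω (c n')) ((j : ℝ≥0) / 2 ^ n) ω)) ^ 2 := by
    rw [Finset.sum_comm]; exact Finset.sum_congr rfl fun k _ => Finset.sum_comm
  have hsw2 : ∑ j ∈ range N, ∑ k, ∑ n', clamp n (σ k n' ((j : ℝ≥0) / 2 ^ n) ω) ^ 2 * (W (((j + 1 : ℕ) : ℝ≥0) / 2 ^ n) ω (c n') - W ((j : ℝ≥0) / 2 ^ n) ω (c n')) ^ 2 =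
      ∑ k, ∑ n', ∑ j ∈ range N, clamp n (σ k n' ((j : ℝ≥0) / 2 ^ n) ω) ^ 2 * (W (((j + 1 : ℕ) : ℝ≥0) / 2 ^ n) ω (c n') - W ((j : ℝ≥0) / 2 ^ n) ω (c n')) ^ 2 := by
    rw [Finset.sum_comm]; exact Finset.sum_congr rfl fun k _ => Finset.sum_comm
  rw [← hsw1, ← hsw2]
  linarith [hTI, hG, hθM]

/-- **The level-`n` bound, integrated** (see the file header). [folklore] -/
theorem level_integral [IsProbabilityMeasure P] (hW : IsBrownianVec W P) {ι κ : Type} [Fintype ι]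
    [Fintype κ] [DecidableEq κ] (c : κ → Fin d) (Y b : ι → ℝ≥0 → Ω → ℝ) (σ J' : ι → κ → ℝ≥0 → Ω → ℝ)
    (y₀ : ι → ℝ) (hσa : ∀ k n', Adapted hW.natFiltration (σ k n'))
    (hYp : ∀ k, IsStronglyProgressive hW.natFiltration (Y k))
    (hbp : ∀ k, IsStronglyProgressive hW.natFiltration (b k))
    (hσsup : ∀ k n' (t : ℝ≥0), ∫⁻ ω, ⨆ s ∈ Set.Iic t, ENNReal.ofReal (σ k n' s ω ^ 2) ∂P < ⊤)
    (hfin : ∀ k n' (t : ℝ≥0), sqErr (σ k n') 0 P t ≠ ⊤)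
    (hJ' : ∀ k n', IsItoIntegral (σ k n') (fun t ω => W t ω (c n')) (J' k n') hW.natFiltration P ∧
      Martingale (J' k n') hW.natFiltration P ∧ ∀ t, MemLp (J' k n' t) 2 P)
    (hσp : ∀ k n', IsStronglyProgressive hW.natFiltration (σ k n')) (hc : Function.Injective c)
    (hbc : ∀ᵐ ω ∂P, ∀ k, Continuous fun t => b k t ω)
    (hXeq : ∀ᵐ ω ∂P, ∀ (t : ℝ≥0) (k : ι),
      Y k t ω = y₀ k + (∫ s in (0 : ℝ)..t, b k s.toNNReal ω) + ∑ n', J' k n' t ω)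
    (hT2 : ∀ (t : ℝ≥0) (ω : Ω) (n' : κ), ∑ k, Y k t ω * σ k n' t ω = 0)
    {t : ℝ≥0} {n N C : ℕ} (hN : N ≤ n * 2 ^ n) (hNt : ((N : ℝ≥0) / 2 ^ n) ≤ t) (hCn : C ≤ n)
    {θ : ℝ} (hθ : 0 < θ) :
    ∫ ω, min 1 |(∑ k, Y k ((N : ℝ≥0) / 2 ^ n) ω ^ 2 - ∑ k, Y k 0 ω ^ 2)| * ({ω | ∀ k (m j : ℕ), ((j : ℝ≥0) / 2 ^ m) ≤ t → |Y k ((j : ℝ≥0) / 2 ^ m) ω| ≤ C} ∩ {ω | ∀ k n' (m j : ℕ), ((j : ℝ≥0) / 2 ^ m) ≤ t → |σ k n' ((j : ℝ≥0) / 2 ^ m) ω| ≤ n}).indicator 1 ω ∂P ≤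
      (∫ ω, min 1 |(∑ j ∈ range N, ∑ k, 2 * Y k ((j : ℝ≥0) / 2 ^ n) ω * (∫ s in ((((j : ℝ≥0) / 2 ^ n : ℝ≥0)) : ℝ)..((((j + 1 : ℕ) : ℝ≥0) / 2 ^ n : ℝ≥0) : ℝ), b k s.toNNReal ω) + ∑ j ∈ range N, ∑ k, ∑ n', clamp n (σ k n' ((j : ℝ≥0) / 2 ^ n) ω) ^ 2 * (1 / 2 ^ n))| ∂P) + ∑ k, ∑ n', 2 * Real.sqrt (C ^ 2 * (4 * sqErr (σ k n') (SimpleProcess.sample (σ k n') (hσa k n') n).toProcess P t).toReal) + (∑ _k : ι, ∑ _n' : κ, Real.sqrt ((gaussFourthMoment - 1) * ((n : ℝ) ^ 2) ^ 2 * (N * (1 / 2 ^ n) ^ 2)) + ∑ _k : ι, ∑ n' : κ, ∑ _n'' ∈ univ.erase n', Real.sqrt (((n : ℝ) ^ 2) ^ 2 * (N * (1 / 2 ^ n) ^ 2))) + (1 + 1 / θ) * ((∫ ω, min 1 (2 * ∑ j ∈ range N, ∑ k, (∫ s in ((((j : ℝ≥0) / 2 ^ n : ℝ≥0)) : ℝ)..((((j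 + 1 : ℕ) : ℝ≥0) / 2 ^ n : ℝ≥0) : ℝ), b k s.toNNReal ω) ^ 2) ∂P) + 2 * Fintype.card κ * ∑ k, ∑ n', (4 * sqErr (σ k n') (SimpleProcess.sample (σ k n') (hσa k n') n).toProcess P t).toReal) + θ * (Fintype.card κ * ∑ k : ι, ∑ n', (N * ((1 / 2 ^ n) * (∫⁻ ω, ⨆ s ∈ Set.Iic t, ENNReal.ofReal (σ k n' s ω ^ 2) ∂P).toReal))) := by
  -- (0) measurability of the basic random variables
  have hYm : ∀ k (s : ℝ≥0), Measurable fun ω => Y k s ω := fun k s =>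
    ((hYp k).stronglyAdapted s).measurable.mono (hW.natFiltration.le s) le_rfl
  have hσm : ∀ k n' (s : ℝ≥0), Measurable fun ω => σ k n' s ω := fun k n' s =>
    (hσa k n' s).mono (hW.natFiltration.le s) le_rfl
  have hstm : ∀ k n' (s : ℝ≥0), Measurable fun ω => clamp n (σ k n' s ω) := fun k n' s =>
    (continuous_clamp _).measurable.comp (hσm k n' s)
  have hstm' : ∀ k n' (s : ℝ≥0), Measurable[hW.natFiltration s] fun ω => clamp n (σ k n' s ω) := fun k n' s =>
    (continuous_clamp _).measurable.comp (hσa k n' s)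
  have hWm : ∀ (s : ℝ≥0) (q : Fin d), Measurable fun ω => W s ω q := fun s q => measurable_coord hW s q
  have hgrid : ∀ j : ℕ, ((((j : ℝ≥0) / 2 ^ n : ℝ≥0)) : ℝ) ≤ ((((j + 1 : ℕ) : ℝ≥0) / 2 ^ n : ℝ≥0) : ℝ) := fun j => by
    rw [coe_dyadicGrid, coe_dyadicGrid]
    exact div_le_div_of_nonneg_right (by exact_mod_cast Nat.le_succ j) (pow_pos two_pos n).le
  have hdAm : ∀ k (j : ℕ), Measurable fun ω => (∫ s in ((((j : ℝ≥0) / 2 ^ n : ℝ≥0)) : ℝ)..((((j + 1 : ℕ) : ℝ≥0) / 2 ^ n : ℝ≥0) : ℝ), b k s.toNNReal ω) := fun k j =>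
    ((stronglyMeasurable_intervalIntegral_of_isStronglyProgressive (hbp k) (hgrid j)
      (le_rfl : ((((j + 1 : ℕ) : ℝ≥0) / 2 ^ n : ℝ≥0) : ℝ) ≤ ((((j + 1 : ℕ) : ℝ≥0) / 2 ^ n : ℝ≥0) : ℝ))).measurable).mono (hW.natFiltration.le _) le_rfl
  have hdIm : ∀ k n' (j : ℕ), Measurable fun ω => ((J' k n' (((j + 1 : ℕ) : ℝ≥0) / 2 ^ n) ω - (SimpleProcess.sample (σ k n') (hσa k n') n).integral (fun t ω => W t ω (c n')) (((j + 1 : ℕ) : ℝ≥0) / 2 ^ n) ω) - (J' k n' ((j : ℝ≥0) / 2 ^ n) ω - (SimpleProcess.sample (σ k n') (hσa k n') n).integral (fun t ω => W t ω (c n')) ((j : ℝ≥0) / 2 ^ n) ω)) := by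
    intro k n' j
    have hJm : ∀ s : ℝ≥0, Measurable fun ω => J' k n' s ω := fun s =>
      ((hJ' k n').2.1.1 s).measurable.mono (hW.natFiltration.le s) le_rfl
    have hKm : ∀ s : ℝ≥0, Measurable fun ω => (SimpleProcess.sample (σ k n') (hσa k n') n).integral (fun t ω => W t ω (c n')) s ω := fun s =>
      (((SimpleProcess.sample (σ k n') (hσa k n') n).stronglyAdapted_integral (stronglyAdapted_coord hW (c n')) s).measurable).mono
        (hW.natFiltration.le s) le_rfl
    exact ((hJm _).sub (hKm _)).sub ((hJm _).sub (hKm _))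
  -- (1) the integrable majorant, term by term
  have hbdd : ∀ {f : Ω → ℝ}, Measurable f → Integrable (fun ω => min 1 |f ω|) P := fun {f} hf =>
    (integrable_const (1 : ℝ)).mono' (measurable_const.min hf.abs).aestronglyMeasurable
      (ae_of_all _ fun ω => by
        rw [Real.norm_eq_abs, abs_of_nonneg (le_min zero_le_one (abs_nonneg _))]; exact min_le_left _ _)
  have hPATHm : Measurable fun ω => (∑ j ∈ range N, ∑ k, 2 * Y k ((j : ℝ≥0) / 2 ^ n) ω * (∫ s in ((((j : ℝ≥0) / 2 ^ n : ℝ≥0)) : ℝ)..((((j + 1 : ℕ) : ℝ≥0) / 2 ^ n : ℝ≥0) : ℝ), b k s.toNNReal ω) + ∑ j ∈ range N, ∑ k, ∑ n', clamp n (σ k n' ((j : ℝ≥0) / 2 ^ n) ω) ^ 2 * (1 / 2 ^ n)) :=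
    (Finset.measurable_sum _ fun j _ => Finset.measurable_sum _ fun k _ =>
      (measurable_const.mul (hYm k _)).mul (hdAm k j)).add
    (Finset.measurable_sum _ fun j _ => Finset.measurable_sum _ fun k _ => Finset.measurable_sum _ fun n' _ =>
      ((hstm k n' _).pow_const 2).mul_const _)
  have hR1m : Measurable fun ω => (2 * ∑ j ∈ range N, ∑ k, (∫ s in ((((j : ℝ≥0) / 2 ^ n : ℝ≥0)) : ℝ)..((((j + 1 : ℕ) : ℝ≥0) / 2 ^ n : ℝ≥0) : ℝ), b k s.toNNReal ω) ^ 2) :=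
    measurable_const.mul (Finset.measurable_sum _ fun j _ => Finset.measurable_sum _ fun k _ => (hdAm k j).pow_const 2)
  have hR1i : Integrable (fun ω => min 1 (2 * ∑ j ∈ range N, ∑ k, (∫ s in ((((j : ℝ≥0) / 2 ^ n : ℝ≥0)) : ℝ)..((((j + 1 : ℕ) : ℝ≥0) / 2 ^ n : ℝ≥0) : ℝ), b k s.toNNReal ω) ^ 2)) P :=
    (integrable_const (1 : ℝ)).mono' (measurable_const.min hR1m).aestronglyMeasurable
      (ae_of_all _ fun ω => by
        rw [Real.norm_eq_abs, abs_of_nonneg (le_min zero_le_one (by positivity))]; exact min_le_left _ _)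
  have hZa : ∀ k, Adapted hW.natFiltration (fun s ω => clamp C (Y k s ω)) := fun k s =>
    (continuous_clamp _).measurable.comp ((hYp k).stronglyAdapted s).measurable
  have hZb : ∀ k (s : ℝ≥0) ω, |clamp C (Y k s ω)| ≤ (C : ℝ) := fun k s ω =>
    (abs_clamp_le _ _).trans (by rw [Nat.abs_cast])
  have hS : ∀ k n', Integrable (fun ω => (∑ j ∈ range N, clamp n (clamp C (Y k ((j : ℝ≥0) / 2 ^ n) ω)) * ((J' k n' (((j + 1 : ℕ) : ℝ≥0) / 2 ^ n) ω - (SimpleProcess.sample (σ k n') (hσa k n') n).integral (fun t ω => W t ω (c n')) (((j + 1 : ℕ) : ℝ≥0) / 2 ^ n) ω) - (J' k n' ((j : ℝ≥0) / 2 ^ n) ω - (SimpleProcess.sample (σ k n') (hσa k n') n).integral (fun t ω => W t ω (c n')) ((j : ℝ≥0) / 2 ^ n) ω)))) P ∧ ∫ ω, |(∑ j ∈ range N, clamp n (clamp C (Y k ((j : ℝ≥0) / 2 ^ n) ω)) * ((J' k n' (((j + 1 : ℕ) : ℝ≥0) / 2 ^ n) ω - (SimpleProcess.sample (σ k n') (hσa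 k n') n).integral (fun t ω => W t ω (c n')) (((j + 1 : ℕ) : ℝ≥0) / 2 ^ n) ω) - (J' k n' ((j : ℝ≥0) / 2 ^ n) ω - (SimpleProcess.sample (σ k n') (hσa k n') n).integral (fun t ω => W t ω (c n')) ((j : ℝ≥0) / 2 ^ n) ω)))| ∂P ≤ Real.sqrt (C ^ 2 * (4 * sqErr (σ k n') (SimpleProcess.sample (σ k n') (hσa k n') n).toProcess P t).toReal) :=
    fun k n' => weighted_samplingErr_dyadic hW (c n') (hσp k n') (hσa k n') (hJ' k n').1 (hJ' k n').2.1
      (hJ' k n').2.2 (hZa k) (hZb k) n N hN hNt (hfin k n' t)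
  have hξ1 : ∀ k n' (j : ℕ) ω, |clamp n (σ k n' ((j : ℝ≥0) / 2 ^ n) ω) ^ 2| ≤ ((n : ℝ) ^ 2) := fun k n' j ω => by
    rw [abs_pow]; exact pow_le_pow_left₀ (abs_nonneg _) ((abs_clamp_le _ _).trans (by rw [Nat.abs_cast])) 2
  have hξ2 : ∀ k n' n'' (j : ℕ) ω, |clamp n (σ k n' ((j : ℝ≥0) / 2 ^ n) ω) * clamp n (σ k n'' ((j : ℝ≥0) / 2 ^ n) ω)| ≤ ((n : ℝ) ^ 2) :=
    fun k n' n'' j ω => by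
      rw [abs_mul, sq]
      exact mul_le_mul ((abs_clamp_le _ _).trans (by rw [Nat.abs_cast]))
        ((abs_clamp_le _ _).trans (by rw [Nat.abs_cast])) (abs_nonneg _) (Nat.cast_nonneg n)
  have hGD : ∀ k n', Integrable (fun ω => (∑ j ∈ range N, clamp n (σ k n' ((j : ℝ≥0) / 2 ^ n) ω) ^ 2 * ((W (((j + 1 : ℕ) : ℝ≥0) / 2 ^ n) ω (c n') - W ((j : ℝ≥0) / 2 ^ n) ω (c n')) ^ 2 - 1 / 2 ^ n))) P ∧
      ∫ ω, |(∑ j ∈ range N, clamp n (σ k n' ((j : ℝ≥0) / 2 ^ n) ω) ^ 2 * ((W (((j + 1 : ℕ) : ℝ≥0) / 2 ^ n) ω (c n') - W ((j : ℝ≥0) / 2 ^ n) ω (c n')) ^ 2 - 1 / 2 ^ n))| ∂P ≤ Real.sqrt ((gaussFourthMoment - 1) * ((n : ℝ) ^ 2) ^ 2 * (N * (1 / 2 ^ n) ^ 2)) :=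
    fun k n' => gauss_diag_dyadic hW n (ξ := fun j ω => clamp n (σ k n' ((j : ℝ≥0) / 2 ^ n) ω) ^ 2)
      (fun j => (hstm' k n' _).pow_const 2) (hξ1 k n') (c n') N
  have hGO : ∀ k n', ∀ n'' ∈ univ.erase n', Integrable (fun ω => (∑ j ∈ range N, (clamp n (σ k n' ((j : ℝ≥0) / 2 ^ n) ω) * clamp n (σ k n'' ((j : ℝ≥0) / 2 ^ n) ω)) * ((W (((j + 1 : ℕ) : ℝ≥0) / 2 ^ n) ω (c n') - W ((j : ℝ≥0) / 2 ^ n) ω (c n')) * (W (((j + 1 : ℕ) : ℝ≥0) / 2 ^ n) ω (c n'') - W ((j : ℝ≥0) / 2 ^ n) ω (c n''))))) P ∧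
      ∫ ω, |(∑ j ∈ range N, (clamp n (σ k n' ((j : ℝ≥0) / 2 ^ n) ω) * clamp n (σ k n'' ((j : ℝ≥0) / 2 ^ n) ω)) * ((W (((j + 1 : ℕ) : ℝ≥0) / 2 ^ n) ω (c n') - W ((j : ℝ≥0) / 2 ^ n) ω (c n')) * (W (((j + 1 : ℕ) : ℝ≥0) / 2 ^ n) ω (c n'') - W ((j : ℝ≥0) / 2 ^ n) ω (c n''))))| ∂P ≤ Real.sqrt (((n : ℝ) ^ 2) ^ 2 * (N * (1 / 2 ^ n) ^ 2)) :=
    fun k n' n'' hn'' => gauss_offDiag_dyadic hW n (ξ := fun j ω => clamp n (σ k n' ((j : ℝ≥0) / 2 ^ n) ω) * clamp n (σ k n'' ((j : ℝ≥0) / 2 ^ n) ω))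
      (fun j => (hstm' k n' _).mul (hstm' k n'' _)) (hξ2 k n' n'')
      (fun h => (Finset.mem_erase.1 hn'').1 (hc h).symm) N
  have hQ : ∀ k n', Integrable (fun ω => ∑ j ∈ range N, ((J' k n' (((j + 1 : ℕ) : ℝ≥0) / 2 ^ n) ω - (SimpleProcess.sample (σ k n') (hσa k n') n).integral (fun t ω => W t ω (c n')) (((j + 1 : ℕ) : ℝ≥0) / 2 ^ n) ω) - (J' k n' ((j : ℝ≥0) / 2 ^ n) ω - (SimpleProcess.sample (σ k n') (hσa k n') n).integral (fun t ω => W t ω (c n')) ((j : ℝ≥0) / 2 ^ n) ω)) ^ 2) P ∧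
      ∫ ω, ∑ j ∈ range N, ((J' k n' (((j + 1 : ℕ) : ℝ≥0) / 2 ^ n) ω - (SimpleProcess.sample (σ k n') (hσa k n') n).integral (fun t ω => W t ω (c n')) (((j + 1 : ℕ) : ℝ≥0) / 2 ^ n) ω) - (J' k n' ((j : ℝ≥0) / 2 ^ n) ω - (SimpleProcess.sample (σ k n') (hσa k n') n).integral (fun t ω => W t ω (c n')) ((j : ℝ≥0) / 2 ^ n) ω)) ^ 2 ∂P ≤ (4 * sqErr (σ k n') (SimpleProcess.sample (σ k n') (hσa k n') n).toProcess P t).toReal :=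
    fun k n' => quadSum_samplingErr_dyadic hW (c n') (hσp k n') (hσa k n') (hJ' k n').1 (hJ' k n').2.1
      (hJ' k n').2.2 n N hNt (hfin k n' t)
  have hMt : ∀ k n', ∀ j ∈ range N, Integrable (fun ω => clamp n (σ k n' ((j : ℝ≥0) / 2 ^ n) ω) ^ 2 * (W (((j + 1 : ℕ) : ℝ≥0) / 2 ^ n) ω (c n') - W ((j : ℝ≥0) / 2 ^ n) ω (c n')) ^ 2) P ∧
      ∫ ω, clamp n (σ k n' ((j : ℝ≥0) / 2 ^ n) ω) ^ 2 * (W (((j + 1 : ℕ) : ℝ≥0) / 2 ^ n) ω (c n') - W ((j : ℝ≥0) / 2 ^ n) ω (c n')) ^ 2 ∂P ≤ (1 / 2 ^ n) * (∫⁻ ω, ⨆ s ∈ Set.Iic t, ENNReal.ofReal (σ k n' s ω ^ 2) ∂P).toReal :=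
    fun k n' j hj => sampledSq_mul_incrSq_dyadic hW (c n') (hσa k n') (hσsup k n') n j
      (dyadicGrid_le hNt (mem_range.1 hj).le)
  -- integrability of the five blocks
  have hI1 : Integrable (fun ω => min 1 |(∑ j ∈ range N, ∑ k, 2 * Y k ((j : ℝ≥0) / 2 ^ n) ω * (∫ s in ((((j : ℝ≥0) / 2 ^ n : ℝ≥0)) : ℝ)..((((j + 1 : ℕ) : ℝ≥0) / 2 ^ n : ℝ≥0) : ℝ), b k s.toNNReal ω) + ∑ j ∈ range N, ∑ k, ∑ n', clamp n (σ k n' ((j : ℝ≥0) / 2 ^ n) ω) ^ 2 * (1 / 2 ^ n))|) P := hbdd hPATHm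
  have hI2 : Integrable (fun ω => ∑ k, ∑ n', 2 * |(∑ j ∈ range N, clamp n (clamp C (Y k ((j : ℝ≥0) / 2 ^ n) ω)) * ((J' k n' (((j + 1 : ℕ) : ℝ≥0) / 2 ^ n) ω - (SimpleProcess.sample (σ k n') (hσa k n') n).integral (fun t ω => W t ω (c n')) (((j + 1 : ℕ) : ℝ≥0) / 2 ^ n) ω) - (J' k n' ((j : ℝ≥0) / 2 ^ n) ω - (SimpleProcess.sample (σ k n') (hσa k n') n).integral (fun t ω => W t ω (c n')) ((j : ℝ≥0) / 2 ^ n) ω)))|) P :=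
    integrable_finsetSum _ fun k _ => integrable_finsetSum _ fun n' _ => ((hS k n').1.abs.const_mul 2)
  have hI3 : Integrable (fun ω => ∑ k, ∑ n', |(∑ j ∈ range N, clamp n (σ k n' ((j : ℝ≥0) / 2 ^ n) ω) ^ 2 * ((W (((j + 1 : ℕ) : ℝ≥0) / 2 ^ n) ω (c n') - W ((j : ℝ≥0) / 2 ^ n) ω (c n')) ^ 2 - 1 / 2 ^ n))| + ∑ k, ∑ n', ∑ n'' ∈ univ.erase n', |(∑ j ∈ range N, (clamp n (σ k n' ((j : ℝ≥0) / 2 ^ n) ω) * clamp n (σ k n'' ((j : ℝ≥0) / 2 ^ n) ω)) * ((W (((j + 1 : ℕ) : ℝ≥0) / 2 ^ n) ω (c n') - W ((j : ℝ≥0) / 2 ^ n) ω (c n')) * (W (((j + 1 : ℕ) : ℝ≥0) / 2 ^ n) ω (c n'') - W ((j : ℝ≥0) / 2 ^ n) ω (c n''))))|) P :=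
    (integrable_finsetSum _ fun k _ => integrable_finsetSum _ fun n' _ => (hGD k n').1.abs).add
      (integrable_finsetSum _ fun k _ => integrable_finsetSum _ fun n' _ => integrable_finsetSum _ fun n'' hn'' =>
        (hGO k n' n'' hn'').1.abs)
  have hI4 : Integrable (fun ω => (1 + 1 / θ) * (min 1 (2 * ∑ j ∈ range N, ∑ k, (∫ s in ((((j : ℝ≥0) / 2 ^ n : ℝ≥0)) : ℝ)..((((j + 1 : ℕ) : ℝ≥0) / 2 ^ n : ℝ≥0) : ℝ), b k s.toNNReal ω) ^ 2) + (2 * Fintype.card κ * ∑ k, ∑ n', ∑ j ∈ range N, ((J' k n' (((j + 1 : ℕ) : ℝ≥0) / 2 ^ n) ω - (SimpleProcess.sample (σ k n') (hσa k n') n).integral (fun t ω => W t ω (c n')) (((j + 1 : ℕ) : ℝ≥0) / 2 ^ n) ω) - (J' k n' ((j : ℝ≥0) / 2 ^ n) ω - (SimpleProcess.sample (σ k n') (hσa k n') n).integral (fun t ω => W t ω (c n')) ((j : ℝ≥0) / 2 ^ n) ω)) ^ 2))) P :=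
    (hR1i.add ((integrable_finsetSum _ fun k _ => integrable_finsetSum _ fun n' _ => (hQ k n').1).const_mul
      _)).const_mul _
  have hI5 : Integrable (fun ω => θ * (Fintype.card κ * ∑ k, ∑ n', ∑ j ∈ range N, clamp n (σ k n' ((j : ℝ≥0) / 2 ^ n) ω) ^ 2 * (W (((j + 1 : ℕ) : ℝ≥0) / 2 ^ n) ω (c n') - W ((j : ℝ≥0) / 2 ^ n) ω (c n')) ^ 2)) P :=
    ((integrable_finsetSum _ fun k _ => integrable_finsetSum _ fun n' _ => integrable_finsetSum _ fun j hj =>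
      (hMt k n' j hj).1).const_mul _).const_mul _
  -- (2) the a.e. pointwise inequality
  have hae := level_pointwise hW c Y b σ J' y₀ hσa hbc hXeq hT2 hN hNt hCn hθ
  have hE : MeasurableSet ({ω | ∀ k (m j : ℕ), ((j : ℝ≥0) / 2 ^ m) ≤ t → |Y k ((j : ℝ≥0) / 2 ^ m) ω| ≤ C} ∩ {ω | ∀ k n' (m j : ℕ), ((j : ℝ≥0) / 2 ^ m) ≤ t → |σ k n' ((j : ℝ≥0) / 2 ^ m) ω| ≤ n}) := by
    refine MeasurableSet.inter ?_ ?_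
    · simp only [Set.setOf_forall]
      exact MeasurableSet.iInter fun k => MeasurableSet.iInter fun m => MeasurableSet.iInter fun j =>
        MeasurableSet.iInter fun _ => measurableSet_le (hYm k _).abs measurable_const
    · simp only [Set.setOf_forall]
      exact MeasurableSet.iInter fun k => MeasurableSet.iInter fun n' => MeasurableSet.iInter fun m =>
        MeasurableSet.iInter fun j => MeasurableSet.iInter fun _ => measurableSet_le (hσm k n' _).abs measurable_const
  have hZm : Measurable fun ω => min 1 |(∑ k, Y k ((N : ℝ≥0) / 2 ^ n) ω ^ 2 - ∑ k, Y k 0 ω ^ 2)| :=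
    measurable_const.min ((Finset.measurable_sum _ fun k _ => (hYm k _).pow_const 2).sub
      (Finset.measurable_sum _ fun k _ => (hYm k _).pow_const 2)).abs
  have hI0 : Integrable (fun ω => min 1 |(∑ k, Y k ((N : ℝ≥0) / 2 ^ n) ω ^ 2 - ∑ k, Y k 0 ω ^ 2)| * ({ω | ∀ k (m j : ℕ), ((j : ℝ≥0) / 2 ^ m) ≤ t → |Y k ((j : ℝ≥0) / 2 ^ m) ω| ≤ C} ∩ {ω | ∀ k n' (m j : ℕ), ((j : ℝ≥0) / 2 ^ m) ≤ t → |σ k n' ((j : ℝ≥0) / 2 ^ m) ω| ≤ n}).indicator 1 ω) P := by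
    refine (integrable_const (1 : ℝ)).mono' (hZm.mul (measurable_one.indicator hE)).aestronglyMeasurable
      (ae_of_all _ fun ω => ?_)
    rw [Real.norm_eq_abs, abs_mul, abs_of_nonneg (le_min zero_le_one (abs_nonneg _))]
    by_cases hω : ω ∈ {ω | ∀ k (m j : ℕ), ((j : ℝ≥0) / 2 ^ m) ≤ t → |Y k ((j : ℝ≥0) / 2 ^ m) ω| ≤ C} ∩ {ω | ∀ k n' (m j : ℕ), ((j : ℝ≥0) / 2 ^ m) ≤ t → |σ k n' ((j : ℝ≥0) / 2 ^ m) ω| ≤ n}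
    · rw [Set.indicator_of_mem hω, Pi.one_apply, abs_one, mul_one]; exact min_le_left _ _
    · rw [Set.indicator_of_notMem hω, abs_zero, mul_zero]; exact zero_le_one
  have hle : ∀ᵐ ω ∂P, min 1 |(∑ k, Y k ((N : ℝ≥0) / 2 ^ n) ω ^ 2 - ∑ k, Y k 0 ω ^ 2)| * ({ω | ∀ k (m j : ℕ), ((j : ℝ≥0) / 2 ^ m) ≤ t → |Y k ((j : ℝ≥0) / 2 ^ m) ω| ≤ C} ∩ {ω | ∀ k n' (m j : ℕ), ((j : ℝ≥0) / 2 ^ m) ≤ t → |σ k n' ((j : ℝ≥0) / 2 ^ m) ω| ≤ n}).indicator 1 ω ≤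
      min 1 |(∑ j ∈ range N, ∑ k, 2 * Y k ((j : ℝ≥0) / 2 ^ n) ω * (∫ s in ((((j : ℝ≥0) / 2 ^ n : ℝ≥0)) : ℝ)..((((j + 1 : ℕ) : ℝ≥0) / 2 ^ n : ℝ≥0) : ℝ), b k s.toNNReal ω) + ∑ j ∈ range N, ∑ k, ∑ n', clamp n (σ k n' ((j : ℝ≥0) / 2 ^ n) ω) ^ 2 * (1 / 2 ^ n))| + ∑ k, ∑ n', 2 * |(∑ j ∈ range N, clamp n (clamp C (Y k ((j : ℝ≥0) / 2 ^ n) ω)) * ((J' k n' (((j + 1 : ℕ) : ℝ≥0) / 2 ^ n) ω - (SimpleProcess.sample (σ k n') (hσa k n') n).integral (fun t ω => W t ω (c n')) (((j + 1 : ℕ) : ℝ≥0) / 2 ^ n) ω) - (J' k n' ((j : ℝ≥0) / 2 ^ n) ω - (SimpleProcess.sample (σ k n') (hσa k n') n).integral (fun t ω => W t ω (c n')) ((j : ℝ≥0) / 2 ^ n) ω)))| + (∑ k, ∑ n', |(∑ j ∈ range N, clamp n (σ k n' ((j : ℝ≥0) / 2 ^ n) ω) ^ 2 * ((W (((j + 1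 : ℕ) : ℝ≥0) / 2 ^ n) ω (c n') - W ((j : ℝ≥0) / 2 ^ n) ω (c n')) ^ 2 - 1 / 2 ^ n))| + ∑ k, ∑ n', ∑ n'' ∈ univ.erase n', |(∑ j ∈ range N, (clamp n (σ k n' ((j : ℝ≥0) / 2 ^ n) ω) * clamp n (σ k n'' ((j : ℝ≥0) / 2 ^ n) ω)) * ((W (((j + 1 : ℕ) : ℝ≥0) / 2 ^ n) ω (c n') - W ((j : ℝ≥0) / 2 ^ n) ω (c n')) * (W (((j + 1 : ℕ) : ℝ≥0) / 2 ^ n) ω (c n'') - W ((j : ℝ≥0) / 2 ^ n) ω (c n''))))|) +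
      (1 + 1 / θ) * (min 1 (2 * ∑ j ∈ range N, ∑ k, (∫ s in ((((j : ℝ≥0) / 2 ^ n : ℝ≥0)) : ℝ)..((((j + 1 : ℕ) : ℝ≥0) / 2 ^ n : ℝ≥0) : ℝ), b k s.toNNReal ω) ^ 2) + (2 * Fintype.card κ * ∑ k, ∑ n', ∑ j ∈ range N, ((J' k n' (((j + 1 : ℕ) : ℝ≥0) / 2 ^ n) ω - (SimpleProcess.sample (σ k n') (hσa k n') n).integral (fun t ω => W t ω (c n')) (((j + 1 : ℕ) : ℝ≥0) / 2 ^ n) ω) - (J' k n' ((j : ℝ≥0) / 2 ^ n) ω - (SimpleProcess.sample (σ k n') (hσa k n') n).integral (fun t ω => W t ω (c n')) ((j : ℝ≥0) / 2 ^ n) ω)) ^ 2)) + θ * (Fintype.card κ * ∑ k, ∑ n', ∑ j ∈ range N, clamp n (σ k n' ((j : ℝ≥0) / 2 ^ n) ω) ^ 2 * (W (((j + 1 : ℕ) : ℝ≥0) / 2 ^ n) ω (c n') - W ((j : ℝ≥0) / 2 ^ n) ω (c n')) ^ 2) := by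
    filter_upwards [hae] with ω hω
    have hnn : 0 ≤ min 1 |(∑ j ∈ range N, ∑ k, 2 * Y k ((j : ℝ≥0) / 2 ^ n) ω * (∫ s in ((((j : ℝ≥0) / 2 ^ n : ℝ≥0)) : ℝ)..((((j + 1 : ℕ) : ℝ≥0) / 2 ^ n : ℝ≥0) : ℝ), b k s.toNNReal ω) + ∑ j ∈ range N, ∑ k, ∑ n', clamp n (σ k n' ((j : ℝ≥0) / 2 ^ n) ω) ^ 2 * (1 / 2 ^ n))| + ∑ k, ∑ n', 2 * |(∑ j ∈ range N, clamp n (clamp C (Y k ((j : ℝ≥0) / 2 ^ n) ω)) * ((J' k n' (((j + 1 : ℕ) : ℝ≥0) / 2 ^ n) ω - (SimpleProcess.sample (σ k n') (hσa k n') n).integral (fun t ω => W t ω (c n')) (((j + 1 : ℕ) : ℝ≥0) / 2 ^ n) ω) - (J' k n' ((j : ℝ≥0) / 2 ^ n) ω - (SimpleProcess.sample (σ k n') (hσa k n') n).integral (fun t ω => W t ω (c n')) ((j : ℝ≥0) / 2 ^ n) ω)))| +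
        (∑ k, ∑ n', |(∑ j ∈ range N, clamp n (σ k n' ((j : ℝ≥0) / 2 ^ n) ω) ^ 2 * ((W (((j + 1 : ℕ) : ℝ≥0) / 2 ^ n) ω (c n') - W ((j : ℝ≥0) / 2 ^ n) ω (c n')) ^ 2 - 1 / 2 ^ n))| + ∑ k, ∑ n', ∑ n'' ∈ univ.erase n', |(∑ j ∈ range N, (clamp n (σ k n' ((j : ℝ≥0) / 2 ^ n) ω) * clamp n (σ k n'' ((j : ℝ≥0) / 2 ^ n) ω)) * ((W (((j + 1 : ℕ) : ℝ≥0) / 2 ^ n) ω (c n') - W ((j : ℝ≥0) / 2 ^ n) ω (c n')) * (W (((j + 1 : ℕ) : ℝ≥0) / 2 ^ n) ω (c n'') - W ((j : ℝ≥0) / 2 ^ n) ω (c n''))))|) +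
        (1 + 1 / θ) * (min 1 (2 * ∑ j ∈ range N, ∑ k, (∫ s in ((((j : ℝ≥0) / 2 ^ n : ℝ≥0)) : ℝ)..((((j + 1 : ℕ) : ℝ≥0) / 2 ^ n : ℝ≥0) : ℝ), b k s.toNNReal ω) ^ 2) + (2 * Fintype.card κ * ∑ k, ∑ n', ∑ j ∈ range N, ((J' k n' (((j + 1 : ℕ) : ℝ≥0) / 2 ^ n) ω - (SimpleProcess.sample (σ k n') (hσa k n') n).integral (fun t ω => W t ω (c n')) (((j + 1 : ℕ) : ℝ≥0) / 2 ^ n) ω) - (J' k n' ((j : ℝ≥0) / 2 ^ n) ω - (SimpleProcess.sample (σ k n') (hσa k n') n).integral (fun t ω => W t ω (c n')) ((j : ℝ≥0) / 2 ^ n) ω)) ^ 2)) + θ * (Fintype.card κ * ∑ k, ∑ n', ∑ j ∈ range N, clamp n (σ k n' ((j : ℝ≥0) / 2 ^ n) ω) ^ 2 * (W (((j + 1 : ℕ) : ℝ≥0) / 2 ^ n) ω (c n') - W ((j : ℝ≥0) / 2 ^ n) ω (c n')) ^ 2) := by positivity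
    by_cases hmem : ω ∈ {ω | ∀ k (m j : ℕ), ((j : ℝ≥0) / 2 ^ m) ≤ t → |Y k ((j : ℝ≥0) / 2 ^ m) ω| ≤ C} ∩ {ω | ∀ k n' (m j : ℕ), ((j : ℝ≥0) / 2 ^ m) ≤ t → |σ k n' ((j : ℝ≥0) / 2 ^ m) ω| ≤ n}
    · rw [Set.indicator_of_mem hmem, Pi.one_apply, mul_one]; exact hω hmem.1 hmem.2
    · rw [Set.indicator_of_notMem hmem, mul_zero]; exact hnn
  -- (3) integrate and bound block by block
  have hI12 : Integrable (fun ω => min 1 |(∑ j ∈ range N, ∑ k, 2 * Y k ((j : ℝ≥0) / 2 ^ n) ω * (∫ s in ((((j : ℝ≥0) / 2 ^ n : ℝ≥0)) : ℝ)..((((j + 1 : ℕ) : ℝ≥0) / 2 ^ n : ℝ≥0) : ℝ), b k s.toNNReal ω) + ∑ j ∈ range N, ∑ k, ∑ n', clamp n (σ k n' ((j : ℝ≥0) / 2 ^ n) ω) ^ 2 * (1 / 2 ^ n))| + ∑ k, ∑ n', 2 * |(∑ j ∈ range N, clamp n (clamp C (Y k ((j : ℝ≥0) / 2 ^ n) ω))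 * ((J' k n' (((j + 1 : ℕ) : ℝ≥0) / 2 ^ n) ω - (SimpleProcess.sample (σ k n') (hσa k n') n).integral (fun t ω => W t ω (c n')) (((j + 1 : ℕ) : ℝ≥0) / 2 ^ n) ω) - (J' k n' ((j : ℝ≥0) / 2 ^ n) ω - (SimpleProcess.sample (σ k n') (hσa k n') n).integral (fun t ω => W t ω (c n')) ((j : ℝ≥0) / 2 ^ n) ω)))|) P := hI1.add hI2
  have hI123 : Integrable (fun ω => min 1 |(∑ j ∈ range N, ∑ k, 2 * Y k ((j : ℝ≥0) / 2 ^ n) ω * (∫ s in ((((j : ℝ≥0) / 2 ^ n : ℝ≥0)) : ℝ)..((((j + 1 : ℕ) : ℝ≥0) / 2 ^ n : ℝ≥0) : ℝ), b k s.toNNReal ω) + ∑ j ∈ range N, ∑ k, ∑ n', clamp n (σ k n' ((j : ℝ≥0) / 2 ^ n) ω) ^ 2 * (1 / 2 ^ n))| + ∑ k, ∑ n', 2 * |(∑ j ∈ range N, clamp n (clamp C (Y k ((j : ℝ≥0) / 2 ^ n) ω)) * ((J' k n' (((j + 1 : ℕ) : ℝ≥0) / 2 ^ n) ω - (SimpleProcess.sample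 (σ k n') (hσa k n') n).integral (fun t ω => W t ω (c n')) (((j + 1 : ℕ) : ℝ≥0) / 2 ^ n) ω) - (J' k n' ((j : ℝ≥0) / 2 ^ n) ω - (SimpleProcess.sample (σ k n') (hσa k n') n).integral (fun t ω => W t ω (c n')) ((j : ℝ≥0) / 2 ^ n) ω)))| +
      (∑ k, ∑ n', |(∑ j ∈ range N, clamp n (σ k n' ((j : ℝ≥0) / 2 ^ n) ω) ^ 2 * ((W (((j + 1 : ℕ) : ℝ≥0) / 2 ^ n) ω (c n') - W ((j : ℝ≥0) / 2 ^ n) ω (c n')) ^ 2 - 1 / 2 ^ n))| + ∑ k, ∑ n', ∑ n'' ∈ univ.erase n', |(∑ j ∈ range N, (clamp n (σ k n' ((j : ℝ≥0) / 2 ^ n) ω) * clamp n (σ k n'' ((j : ℝ≥0) / 2 ^ n) ω)) * ((W (((j + 1 : ℕ) : ℝ≥0) / 2 ^ n) ω (c n') - W ((j : ℝ≥0) / 2 ^ n) ω (c n')) * (W (((j + 1 : ℕ) : ℝ≥0) / 2 ^ n) ω (c n'') - W ((j : ℝ≥0) / 2 ^ n) ω (c n''))))|)) P := hI12.add hI3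
  have hI1234 : Integrable (fun ω => min 1 |(∑ j ∈ range N, ∑ k, 2 * Y k ((j : ℝ≥0) / 2 ^ n) ω * (∫ s in ((((j : ℝ≥0) / 2 ^ n : ℝ≥0)) : ℝ)..((((j + 1 : ℕ) : ℝ≥0) / 2 ^ n : ℝ≥0) : ℝ), b k s.toNNReal ω) + ∑ j ∈ range N, ∑ k, ∑ n', clamp n (σ k n' ((j : ℝ≥0) / 2 ^ n) ω) ^ 2 * (1 / 2 ^ n))| + ∑ k, ∑ n', 2 * |(∑ j ∈ range N, clamp n (clamp C (Y k ((j : ℝ≥0) / 2 ^ n) ω)) * ((J' k n' (((j + 1 : ℕ) : ℝ≥0) / 2 ^ n) ω - (SimpleProcess.sample (σ k n') (hσa k n') n).integral (fun t ω => W t ω (c n')) (((j + 1 : ℕ) : ℝ≥0) / 2 ^ n) ω) - (J' k n' ((j : ℝ≥0) / 2 ^ n) ω - (SimpleProcess.sample (σ k n') (hσa k n') n).integral (fun t ω => W t ω (c n')) ((j : ℝ≥0) / 2 ^ n) ω)))| +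
      (∑ k, ∑ n', |(∑ j ∈ range N, clamp n (σ k n' ((j : ℝ≥0) / 2 ^ n) ω) ^ 2 * ((W (((j + 1 : ℕ) : ℝ≥0) / 2 ^ n) ω (c n') - W ((j : ℝ≥0) / 2 ^ n) ω (c n')) ^ 2 - 1 / 2 ^ n))| + ∑ k, ∑ n', ∑ n'' ∈ univ.erase n', |(∑ j ∈ range N, (clamp n (σ k n' ((j : ℝ≥0) / 2 ^ n) ω) * clamp n (σ k n'' ((j : ℝ≥0) / 2 ^ n) ω)) * ((W (((j + 1 : ℕ) : ℝ≥0) / 2 ^ n) ω (c n') - W ((j : ℝ≥0) / 2 ^ n) ω (c n')) * (W (((j + 1 : ℕ) : ℝ≥0) / 2 ^ n) ω (c n'') - W ((j : ℝ≥0) / 2 ^ n) ω (c n''))))|) +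
      (1 + 1 / θ) * (min 1 (2 * ∑ j ∈ range N, ∑ k, (∫ s in ((((j : ℝ≥0) / 2 ^ n : ℝ≥0)) : ℝ)..((((j + 1 : ℕ) : ℝ≥0) / 2 ^ n : ℝ≥0) : ℝ), b k s.toNNReal ω) ^ 2) + (2 * Fintype.card κ * ∑ k, ∑ n', ∑ j ∈ range N, ((J' k n' (((j + 1 : ℕ) : ℝ≥0) / 2 ^ n) ω - (SimpleProcess.sample (σ k n') (hσa k n') n).integral (fun t ω => W t ω (c n')) (((j + 1 : ℕ) : ℝ≥0) / 2 ^ n) ω) - (J' k n' ((j : ℝ≥0) / 2 ^ n) ω - (SimpleProcess.sample (σ k n') (hσa k n') n).integral (fun t ω => W t ω (c n')) ((j : ℝ≥0) / 2 ^ n) ω)) ^ 2))) P := hI123.add hI4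
  have hIR : Integrable (fun ω => min 1 |(∑ j ∈ range N, ∑ k, 2 * Y k ((j : ℝ≥0) / 2 ^ n) ω * (∫ s in ((((j : ℝ≥0) / 2 ^ n : ℝ≥0)) : ℝ)..((((j + 1 : ℕ) : ℝ≥0) / 2 ^ n : ℝ≥0) : ℝ), b k s.toNNReal ω) + ∑ j ∈ range N, ∑ k, ∑ n', clamp n (σ k n' ((j : ℝ≥0) / 2 ^ n) ω) ^ 2 * (1 / 2 ^ n))| + ∑ k, ∑ n', 2 * |(∑ j ∈ range N, clamp n (clamp C (Y k ((j : ℝ≥0) / 2 ^ n) ω)) * ((J' k n' (((j + 1 : ℕ) : ℝ≥0) / 2 ^ n) ω - (SimpleProcess.sample (σ k n') (hσa k n') n).integral (fun t ω => W t ω (c n')) (((j + 1 : ℕ) : ℝ≥0) / 2 ^ n) ω) - (J' k n' ((j : ℝ≥0) / 2 ^ n) ω - (SimpleProcess.sample (σ k n') (hσa k n') n).integral (fun t ω => W t ω (c n')) ((j : ℝ≥0) / 2 ^ n) ω)))| +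
      (∑ k, ∑ n', |(∑ j ∈ range N, clamp n (σ k n' ((j : ℝ≥0) / 2 ^ n) ω) ^ 2 * ((W (((j + 1 : ℕ) : ℝ≥0) / 2 ^ n) ω (c n') - W ((j : ℝ≥0) / 2 ^ n) ω (c n')) ^ 2 - 1 / 2 ^ n))| + ∑ k, ∑ n', ∑ n'' ∈ univ.erase n', |(∑ j ∈ range N, (clamp n (σ k n' ((j : ℝ≥0) / 2 ^ n) ω) * clamp n (σ k n'' ((j : ℝ≥0) / 2 ^ n) ω)) * ((W (((j + 1 : ℕ) : ℝ≥0) / 2 ^ n) ω (c n') - W ((j : ℝ≥0) / 2 ^ n) ω (c n')) * (W (((j + 1 : ℕ) : ℝ≥0) / 2 ^ n) ω (c n'') - W ((j : ℝ≥0) / 2 ^ n) ω (c n''))))|) +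
      (1 + 1 / θ) * (min 1 (2 * ∑ j ∈ range N, ∑ k, (∫ s in ((((j : ℝ≥0) / 2 ^ n : ℝ≥0)) : ℝ)..((((j + 1 : ℕ) : ℝ≥0) / 2 ^ n : ℝ≥0) : ℝ), b k s.toNNReal ω) ^ 2) + (2 * Fintype.card κ * ∑ k, ∑ n', ∑ j ∈ range N, ((J' k n' (((j + 1 : ℕ) : ℝ≥0) / 2 ^ n) ω - (SimpleProcess.sample (σ k n') (hσa k n') n).integral (fun t ω => W t ω (c n')) (((j + 1 : ℕ) : ℝ≥0) / 2 ^ n) ω) - (J' k n' ((j : ℝ≥0) / 2 ^ n) ω - (SimpleProcess.sample (σ k n') (hσa k n') n).integral (fun t ω => W t ω (c n')) ((j : ℝ≥0) / 2 ^ n) ω)) ^ 2)) + θ * (Fintype.card κ * ∑ k, ∑ n', ∑ j ∈ range N, clamp n (σ k n' ((j : ℝ≥0) / 2 ^ n) ω) ^ 2 * (W (((j + 1 : ℕ) : ℝ≥0) / 2 ^ n) ω (c n') - W ((j : ℝ≥0) / 2 ^ n) ω (c n')) ^ 2)) P := hI1234.add hI5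
  refine (integral_mono_ae hI0 hIR hle).trans ?_
  rw [integral_add hI1234 hI5, integral_add hI123 hI4, integral_add hI12 hI3, integral_add hI1 hI2]
  refine add_le_add (add_le_add (add_le_add (add_le_add le_rfl ?_) ?_) ?_) ?_
  · -- II block
    rw [integral_finsetSum _ fun k _ => integrable_finsetSum _ fun n' _ => ((hS k n').1.abs.const_mul 2)]
    refine Finset.sum_le_sum fun k _ => ?_
    rw [integral_finsetSum _ fun n' _ => ((hS k n').1.abs.const_mul 2)]
    refine Finset.sum_le_sum fun n' _ => ?_
    rw [integral_const_mul]
    exact mul_le_mul_of_nonneg_left (hS k n').2 zero_le_two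
  · -- Gauss block
    rw [integral_add (integrable_finsetSum _ fun k _ => integrable_finsetSum _ fun n' _ => (hGD k n').1.abs)
      (integrable_finsetSum _ fun k _ => integrable_finsetSum _ fun n' _ => integrable_finsetSum _ fun n'' hn'' =>
        (hGO k n' n'' hn'').1.abs)]
    refine add_le_add ?_ ?_
    · rw [integral_finsetSum _ fun k _ => integrable_finsetSum _ fun n' _ => (hGD k n').1.abs]
      refine Finset.sum_le_sum fun k _ => ?_
      rw [integral_finsetSum _ fun n' _ => (hGD k n').1.abs]
      exact Finset.sum_le_sum fun n' _ => (hGD k n').2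
    · rw [integral_finsetSum _ fun k _ => integrable_finsetSum _ fun n' _ => integrable_finsetSum _ fun n'' hn'' =>
        (hGO k n' n'' hn'').1.abs]
      refine Finset.sum_le_sum fun k _ => ?_
      rw [integral_finsetSum _ fun n' _ => integrable_finsetSum _ fun n'' hn'' => (hGO k n' n'' hn'').1.abs]
      refine Finset.sum_le_sum fun n' _ => ?_
      rw [integral_finsetSum _ fun n'' hn'' => (hGO k n' n'' hn'').1.abs]
      exact Finset.sum_le_sum fun n'' hn'' => (hGO k n' n'' hn'').2
  · -- drift / sampling-error block
    rw [integral_const_mul]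
    refine mul_le_mul_of_nonneg_left ?_ (by positivity)
    rw [integral_add hR1i ((integrable_finsetSum _ fun k _ => integrable_finsetSum _ fun n' _ =>
      (hQ k n').1).const_mul _), integral_const_mul]
    refine add_le_add le_rfl (mul_le_mul_of_nonneg_left ?_ (by positivity))
    rw [integral_finsetSum _ fun k _ => integrable_finsetSum _ fun n' _ => (hQ k n').1]
    refine Finset.sum_le_sum fun k _ => ?_
    rw [integral_finsetSum _ fun n' _ => (hQ k n').1]
    exact Finset.sum_le_sum fun n' _ => (hQ k n').2
  · -- `m²` block
    rw [integral_const_mul]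
    refine mul_le_mul_of_nonneg_left ?_ hθ.le
    rw [integral_const_mul]
    refine mul_le_mul_of_nonneg_left ?_ (Nat.cast_nonneg _)
    rw [integral_finsetSum _ fun k _ => integrable_finsetSum _ fun n' _ => integrable_finsetSum _ fun j hj =>
      (hMt k n' j hj).1]
    refine Finset.sum_le_sum fun k _ => ?_
    rw [integral_finsetSum _ fun n' _ => integrable_finsetSum _ fun j hj => (hMt k n' j hj).1]
    refine Finset.sum_le_sum fun n' _ => ?_
    rw [integral_finsetSum _ fun j hj => (hMt k n' j hj).1]
    calc ∑ j ∈ range N, ∫ ω, clamp n (σ k n' ((j : ℝ≥0) / 2 ^ n) ω) ^ 2 * (W (((j + 1 : ℕ) : ℝ≥0) / 2 ^ n) ω (c n') - W ((j : ℝ≥0) / 2 ^ n) ω (c n')) ^ 2 ∂P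
        ≤ ∑ _j ∈ range N, (1 / 2 ^ n) * (∫⁻ ω, ⨆ s ∈ Set.Iic t, ENNReal.ofReal (σ k n' s ω ^ 2) ∂P).toReal := Finset.sum_le_sum fun j hj => (hMt k n' j hj).2
      _ = N * ((1 / 2 ^ n) * (∫⁻ ω, ⨆ s ∈ Set.Iic t, ENNReal.ofReal (σ k n' s ω ^ 2) ∂P).toReal) := by rw [Finset.sum_const, Finset.card_range, nsmul_eq_mul]

end Summit.QuantumFields.YangMills.Theorems.ColdStartUniversality

end
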